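import Literature.Geometry.Riemannian.LinearHeatWeakExistence
import Literature.Geometry.Riemannian.LinearHeatVeryWeakClassical
import Literature.Geometry.Lorentzian.GreenIdentityCompactSupport
import Literature.Geometry.Riemannian.ShrinkerEntropyProofs
import HarnessLib

/-!
# Lions' very weak existence for the static linear heat equation on a complete (non-compact) manifold

Topic `Geometry/Riemannian`; the non-compact, static-metric companion of `LinearHeatWeakExistence.lean`
(closed `M`, time-dependent family, density ratio `ρ`). Let `(M, g)` be a Riemannian manifold modelled on
`ℝⁿ` (Hausdorff, second countable, `T₃` — NOT compact), `Q, G` smooth on `M × ℝ` with `G` compactly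
supported, `a < b` and `Q ≥ 1` on `M × [a, b]`.

* `IsVeryWeakHeatSol g Q G T u` (Prop-structure) — `u` is a very weak solution of
  `∂ₛu = Δ_g u − Qu + G` on `M × T`: `u` is locally integrable on `M × T` and
  `∫ u (−∂ₛζ − Δ_g ζ(·, s) + Qζ) d(V_g ⊗ ds) = ∫ G ζ d(V_g ⊗ ds)` for
  every smooth `ζ` compactly supported in `M × T` (the hypothesis of hypoellipticity,
  `LinearHeatWeakRegularityNoncompact.lean`, and of `LinearHeatClassicalNoncompact.lean`);
* `integrableOn_strip_of_continuous_of_vanish`, `integral_mul_laplaceBeltrami_self_nonpos_cs`,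
  `heatAdjoint_static_add/smul`;
* `energy_le_integral_mul_heatAdjoint_static` — the energy inequality (Trèves 1975, (41.7)) with `ρ ≡ 1`
  for test functions vanishing off `K × ℝ`, `K` compact: `∫_{M×(a,b)} φ² ≤ ∫_{M×(a,b)} φ 𝒜φ`;
* `exists_veryWeak_linearHeat_static` — J.-L. Lions' projection lemma (`lions_projection`) in
  `L²(M × (a, b), V_g ⊗ ds)` with the test space of smooth functions vanishing off `K × ℝ` (`K` compact)
  and for `s ≥ b' < b`: a measurable `u ∈ L²`, zero for `s ∉ (a, b)`, with
  `∫ u 𝒜ζ = ∫_{M×(a,b)} G ζ` for all smooth compactly supported `ζ` with `tsupport ζ ⊆ M × (−∞, b)`;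
* `exists_isVeryWeakHeatSol_static` — when moreover `G = 0` for `s ≤ a`, the zero extension is a very
  weak solution on the whole open half space-time `M × (−∞, b)` (the form consumed by the Cauchy problem,
  `LinearHeatCauchyNoncompact.lean`).

This is the Literature home of the Summits-side `EntropyRungNoncompactShrinkerGapHeatVeryWeakNoncompact{,Aux}`
(route SmoothPoincare4/EntropyRung; not importable from Literature, CONVENTIONS §2). Everything is proved;
no named facts.

## References

* F. Trèves, *Basic Linear Partial Differential Equations*, Academic Press 1975, §41, Lemma 41.2, (41.7),
  Thm. 40.1. [Treves1975]
* J.-L. Lions, *Équations différentielles opérationnelles et problèmes aux limites*, Springer 1961.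
* J. M. Lee, *Introduction to Riemannian Manifolds*, 2nd ed. (2018), Problem 2-23 (a). [Lee2018]
-/

noncomputable section

open scoped Manifold ContDiff ENNReal NNReal Topology InnerProductSpace
open MeasureTheory Set Filter

namespace Literature.Geometry.Riemannian

open Lorentzian Lorentzian.PseudoRiemannianMetric

section VeryWeakStatic

variable {n : ℕ} {M : Type*} [TopologicalSpace M] [T2Space M] [SecondCountableTopology M]
  [ChartedSpace (EuclideanSpace ℝ (Fin n)) M] [IsManifold (𝓡 n) ∞ M] [T3Space M] [MeasurableSpace M]
  [BorelSpace M]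
  {g : PseudoRiemannianMetric (𝓡 n) ∞ (EuclideanSpace ℝ (Fin n)) (TangentSpace (𝓡 n) : M → Type _)}

/-- **Very weak solutions of the static linear heat equation.** For `(M, g)` modelled on `ℝⁿ`, `Q, G`
on `M × ℝ` (as `ℝ → M → ℝ`), an open set of times `T` and `u : M × ℝ → ℝ`: `u` solves
`∂ₛu = Δ_g u − Qu + G` very weakly on `M × T` if `u` is locally integrable on `M × T` for `V_g ⊗ ds` and
`∫ u (−∂ₛζ − Δ_g ζ(·, s) + Qζ) d(V_g ⊗ ds) = ∫ G ζ d(V_g ⊗ ds)` for every smooth `ζ` with compact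
support contained in `M × T` (the transposed problem, density ratio `ρ ≡ 1` of the static metric; the
non-compact, static analogue of `IsVeryWeakHeatSolution` of `LinearHeatWeakFormulation.lean`, whose test
functions need not be compactly supported in space on a closed `M`); this is the transposed form of the
problem in Trèves' proof of Thm. 40.1 via Lemma 41.2, with density ratio `1`.
[cite: Treves1975, §41, Lemma 41.2 and proof of Thm. 40.1 (transposed form)] -/
structure IsVeryWeakHeatSol
    (g : PseudoRiemannianMetric (𝓡 n) ∞ (EuclideanSpace ℝ (Fin n)) (TangentSpace (𝓡 n) : M → Type _))
    (Q G : ℝ → M → ℝ) (T : Set ℝ) (u : M × ℝ → ℝ) : Prop where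
  locallyIntegrableOn : LocallyIntegrableOn u (univ ×ˢ T) (g.riemVolume.prod (volume : Measure ℝ))
  integral_eq : ∀ ζ : M × ℝ → ℝ, ContMDiff ((𝓡 n).prod 𝓘(ℝ, ℝ)) 𝓘(ℝ, ℝ) ∞ ζ → HasCompactSupport ζ →
    tsupport ζ ⊆ univ ×ˢ T →
    ∫ p, u p * (-(deriv (fun s ↦ ζ (p.1, s)) p.2) - g.laplaceBeltrami (fun x ↦ ζ (x, p.2)) p.1 +
        Q p.2 p.1 * ζ p) ∂(g.riemVolume.prod (volume : Measure ℝ)) =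
      ∫ p, G p.2 p.1 * ζ p ∂(g.riemVolume.prod (volume : Measure ℝ))

omit [T2Space M] in
/-- A continuous function on `M × ℝ` vanishing off `K × ℝ`, `K ⊆ M` compact, is integrable on every strip
`M × (a, b)` for `V_g ⊗ ds` (it is integrable on the compact `K × [a, b]`, `V_g` being finite on compact
sets, and vanishes on the rest of the strip). [folklore] -/
theorem integrableOn_strip_of_continuous_of_vanish (hg : g.IsRiemannian) {K : Set M} (hK : IsCompact K)
    {F : M × ℝ → ℝ} (hF : Continuous F) (hF0 : ∀ p : M × ℝ, p.1 ∉ K → F p = 0) (a b : ℝ) :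
    IntegrableOn F (univ ×ˢ Ioo a b) (g.riemVolume.prod (volume : Measure ℝ)) := by
  haveI : IsFiniteMeasureOnCompacts g.riemVolume :=
    CarrilloNi2009_shrinkerLSI.isFiniteMeasureOnCompacts_riemVolume hg
  have h1 : IntegrableOn F (K ×ˢ Icc a b) (g.riemVolume.prod (volume : Measure ℝ)) :=
    hF.continuousOn.integrableOn_compact (hK.prod isCompact_Icc)
  refine h1.of_forall_sdiff_eq_zero (MeasurableSet.univ.prod measurableSet_Ioo) ?_
  rintro p ⟨hp, hp'⟩
  exact hF0 p fun h ↦ hp' ⟨h, Ioo_subset_Icc_self hp.2⟩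

/-- **`∫ u Δ_g u dV_g ≤ 0` for `u ∈ C²_c(M)`** on a (non-compact) Riemannian manifold modelled on `ℝⁿ`:
Green's identity for a compactly supported factor
(`integral_mul_dalembertian_eq_neg_integral_innerDual_of_hasCompactSupport`) gives `= −∫ g⁻¹(du, du) ≤ 0`.
[cite: Lee2018, Problem 2-23 (a)] -/
theorem integral_mul_laplaceBeltrami_self_nonpos_cs (hg : g.IsRiemannian) {u : M → ℝ}
    (hu : ContMDiff (𝓡 n) 𝓘(ℝ, ℝ) 2 u) (huc : HasCompactSupport u) :
    ∫ x, u x * g.laplaceBeltrami u x ∂g.riemVolume ≤ 0 := by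
  haveI : LocallyCompactSpace M := ChartedSpace.locallyCompactSpace (EuclideanSpace ℝ (Fin n)) M
  haveI := g.hasLeviCivita
  haveI := (PseudoRiemannianMetric.ofRiemannian (g.toContMDiffRiemannianMetric hg)).hasLeviCivita
  have h1le : (1 : ℕ∞ω) ≤ (2 : ℕ∞ω) := by norm_cast
  have h1 := integral_mul_dalembertian_eq_neg_integral_innerDual_of_hasCompactSupport
    (g.toContMDiffRiemannianMetric hg) (hu.of_le h1le) huc hu
  simp only [PseudoRiemannianMetric.laplaceBeltrami_eq_dalembertian]
  rw [PseudoRiemannianMetric.riemVolume_eq hg]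
  refine (le_of_eq h1).trans (neg_nonpos.2 (integral_nonneg fun x ↦ ?_))
  exact innerDual_self_nonneg (g.toContMDiffRiemannianMetric hg) x (mvfderiv (𝓡 n) u x).toLinearMap

omit [T2Space M] [SecondCountableTopology M] [T3Space M] [MeasurableSpace M] [BorelSpace M] in
/-- The static adjoint expression `𝒜φ = −∂ₛφ − Δ_g φ(·, s) + Qφ` is additive in `φ`. [folklore] -/
theorem heatAdjoint_static_add (Q : ℝ → M → ℝ) {φ ψ : M × ℝ → ℝ}
    (hφ : ContMDiff ((𝓡 n).prod 𝓘(ℝ, ℝ)) 𝓘(ℝ, ℝ) ∞ φ) (hψ : ContMDiff ((𝓡 n).prod 𝓘(ℝ, ℝ)) 𝓘(ℝ, ℝ) ∞ ψ)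
    (p : M × ℝ) :
    (-(deriv (fun s ↦ φ (p.1, s) + ψ (p.1, s)) p.2) -
        g.laplaceBeltrami (fun x ↦ φ (x, p.2) + ψ (x, p.2)) p.1 + Q p.2 p.1 * (φ p + ψ p)) =
      (-(deriv (fun s ↦ φ (p.1, s)) p.2) - g.laplaceBeltrami (fun x ↦ φ (x, p.2)) p.1 +
        Q p.2 p.1 * φ p) +
      (-(deriv (fun s ↦ ψ (p.1, s)) p.2) - g.laplaceBeltrami (fun x ↦ ψ (x, p.2)) p.1 +
        Q p.2 p.1 * ψ p) := by
  have hd1 := hasDerivAt_time hφ p.1 p.2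
  have hd2 := hasDerivAt_time hψ p.1 p.2
  rw [deriv_fun_add hd1.differentiableAt hd2.differentiableAt, laplaceBeltrami_slice_add g hφ hψ p.2 p.1]
  ring

omit [T2Space M] [SecondCountableTopology M] [T3Space M] [MeasurableSpace M] [BorelSpace M] in
/-- The static adjoint expression `𝒜φ = −∂ₛφ − Δ_g φ(·, s) + Qφ` is homogeneous in `φ`. [folklore] -/
theorem heatAdjoint_static_smul (Q : ℝ → M → ℝ) {φ : M × ℝ → ℝ}
    (hφ : ContMDiff ((𝓡 n).prod 𝓘(ℝ, ℝ)) 𝓘(ℝ, ℝ) ∞ φ) (c : ℝ) (p : M × ℝ) :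
    (-(deriv (fun s ↦ c * φ (p.1, s)) p.2) - g.laplaceBeltrami (fun x ↦ c * φ (x, p.2)) p.1 +
        Q p.2 p.1 * (c * φ p)) =
      c * (-(deriv (fun s ↦ φ (p.1, s)) p.2) - g.laplaceBeltrami (fun x ↦ φ (x, p.2)) p.1 +
        Q p.2 p.1 * φ p) := by
  have hd1 := hasDerivAt_time hφ p.1 p.2
  rw [(hd1.const_mul c).deriv, laplaceBeltrami_slice_smul g hφ c p.2 p.1]
  ring

/-- **The energy inequality for the static heat operator, spatially compactly supported test functions**
(Trèves 1975, (41.7), with `ρ ≡ 1`): on a (non-compact) Riemannian manifold `(M, g)` modelled on `ℝⁿ`, if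
`Q ≥ 1` on `M × [a, b]`, `a < b`, then for every smooth `φ` on `M × ℝ` vanishing off `K × ℝ` (`K`
compact) and for `s ≥ b`,
`∫_{M×(a,b)} φ² d(V_g ⊗ ds) ≤ ∫_{M×(a,b)} φ (−∂ₛφ − Δ_g φ(·, s) + Qφ) d(V_g ⊗ ds)`
(`∫ₐᵇ φ(−∂ₛφ) ds = ½φ(·, a)² ≥ 0` pointwise, `−∫ φΔ_gφ dV_g ≥ 0` by Green's identity with compact support at
each time, and `Q ≥ 1`). [cite: Treves1975, §41, (41.7) and Lemma 41.2] -/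
theorem energy_le_integral_mul_heatAdjoint_static (hg : g.IsRiemannian) {Q : ℝ → M → ℝ}
    (hQ : ContMDiff ((𝓡 n).prod 𝓘(ℝ, ℝ)) 𝓘(ℝ, ℝ) ∞ fun p : M × ℝ ↦ Q p.2 p.1) {a b : ℝ} (hab : a < b)
    (hQ1 : ∀ (x : M) (s : ℝ), s ∈ Icc a b → 1 ≤ Q s x) {K : Set M} (hK : IsCompact K)
    {φ : M × ℝ → ℝ} (hφ : ContMDiff ((𝓡 n).prod 𝓘(ℝ, ℝ)) 𝓘(ℝ, ℝ) ∞ φ)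
    (hφK : ∀ p : M × ℝ, p.1 ∉ K → φ p = 0) (hφb : ∀ (x : M) (s : ℝ), b ≤ s → φ (x, s) = 0) :
    ∫ p in univ ×ˢ Ioo a b, φ p ^ 2 ∂g.riemVolume.prod (volume : Measure ℝ) ≤
      ∫ p in univ ×ˢ Ioo a b, φ p * (-(deriv (fun s ↦ φ (p.1, s)) p.2) -
        g.laplaceBeltrami (fun x ↦ φ (x, p.2)) p.1 + Q p.2 p.1 * φ p)
        ∂g.riemVolume.prod (volume : Measure ℝ) := by
  haveI : LocallyCompactSpace M := ChartedSpace.locallyCompactSpace (EuclideanSpace ℝ (Fin n)) M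
  set μ₀ : Measure M := g.riemVolume with hμ₀
  haveI : IsFiniteMeasureOnCompacts μ₀ := CarrilloNi2009_shrinkerLSI.isFiniteMeasureOnCompacts_riemVolume hg
  have hfam : IsContMDiffFamilyOn ∞ (fun _ : ℝ ↦ g) univ := isContMDiffFamilyOn_const g univ
  set φt : M × ℝ → ℝ := fun p ↦ deriv (fun s ↦ φ (p.1, s)) p.2 with hφt
  set Δφ : M × ℝ → ℝ := fun p ↦ g.laplaceBeltrami (fun x ↦ φ (x, p.2)) p.1 with hΔφ
  have hφts : ContMDiff ((𝓡 n).prod 𝓘(ℝ, ℝ)) 𝓘(ℝ, ℝ) ∞ φt := contMDiff_deriv_time hφ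
  have hΔφs : ContMDiff ((𝓡 n).prod 𝓘(ℝ, ℝ)) 𝓘(ℝ, ℝ) ∞ Δφ := contMDiff_laplaceBeltrami_family hfam hφ
  -- the restricted product measure is a product
  set νt : Measure ℝ := (volume : Measure ℝ).restrict (Ioo a b) with hνt
  haveI : IsFiniteMeasure νt := ⟨by
    rw [hνt, Measure.restrict_apply_univ]; exact measure_Ioo_lt_top⟩
  have hπ : (μ₀.prod (volume : Measure ℝ)).restrict (univ ×ˢ Ioo a b) = μ₀.prod νt := by
    rw [hνt, ← Measure.prod_restrict, Measure.restrict_univ]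
  have hint : ∀ {F : M × ℝ → ℝ}, Continuous F → (∀ p : M × ℝ, p.1 ∉ K → F p = 0) →
      Integrable F (μ₀.prod νt) := fun hF hF0 ↦ by
    rw [← hπ]; exact integrableOn_strip_of_continuous_of_vanish hg hK hF hF0 a b
  -- decomposition of the integrand
  have hdec : ∀ p, φ p * (-(deriv (fun s ↦ φ (p.1, s)) p.2) -
      g.laplaceBeltrami (fun x ↦ φ (x, p.2)) p.1 + Q p.2 p.1 * φ p) =
      -(φ p * φt p) + -(φ p * Δφ p) + Q p.2 p.1 * φ p ^ 2 := by
    intro p; simp only [hφt, hΔφ]; ring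
  rw [hπ]
  simp_rw [hdec]
  have hi1 : Integrable (fun p ↦ -(φ p * φt p)) (μ₀.prod νt) :=
    hint (hφ.continuous.mul hφts.continuous).neg fun p hp ↦ by rw [hφK p hp, zero_mul, neg_zero]
  have hi2 : Integrable (fun p ↦ -(φ p * Δφ p)) (μ₀.prod νt) :=
    hint (hφ.continuous.mul hΔφs.continuous).neg fun p hp ↦ by rw [hφK p hp, zero_mul, neg_zero]
  have hi3 : Integrable (fun p ↦ Q p.2 p.1 * φ p ^ 2) (μ₀.prod νt) :=
    hint (hQ.continuous.mul (hφ.continuous.pow 2)) fun p hp ↦ by rw [hφK p hp]; ring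
  have hi0 : Integrable (fun p ↦ φ p ^ 2) (μ₀.prod νt) :=
    hint (hφ.continuous.pow 2) fun p hp ↦ by rw [hφK p hp]; ring
  -- (1) the time term is nonnegative: `∫ₐᵇ −φ ∂ₛφ ds = ½ φ(x, a)²`
  have h1 : 0 ≤ ∫ p, -(φ p * φt p) ∂μ₀.prod νt := by
    rw [integral_prod _ hi1]
    refine integral_nonneg fun x ↦ ?_
    dsimp only
    have hφx : ∀ s, HasDerivAt (fun s' ↦ φ (x, s')) (φt (x, s)) s := fun s ↦ hasDerivAt_time hφ x s
    have c2 : Continuous fun s ↦ φ (x, s) := (contDiff_slice_time hφ x).continuous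
    have c4 : Continuous fun s ↦ φt (x, s) := (contDiff_slice_time hφts x).continuous
    have hE : ∀ s, HasDerivAt (fun s' ↦ φ (x, s') ^ 2) (2 * φ (x, s) * φt (x, s)) s := by
      intro s
      have hsq : (fun s' ↦ φ (x, s') ^ 2) = fun s' ↦ φ (x, s') * φ (x, s') := funext fun s' ↦ by ring
      rw [hsq]
      exact ((hφx s).fun_mul (hφx s)).congr_deriv (by ring)
    have hcE : Continuous fun s ↦ 2 * φ (x, s) * φt (x, s) := (continuous_const.mul c2).mul c4
    have hFTC : ∫ s in a..b, 2 * φ (x, s) * φt (x, s) = 0 - φ (x, a) ^ 2 := by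
      rw [intervalIntegral.integral_eq_sub_of_hasDerivAt (fun s _ ↦ hE s) (hcE.intervalIntegrable a b),
        hφb x b le_rfl]
      ring
    have hI : ∀ (f : ℝ → ℝ), ∫ s, f s ∂νt = ∫ s in a..b, f s := fun f ↦ by
      rw [hνt, intervalIntegral.integral_of_le hab.le, integral_Ioc_eq_integral_Ioo]
    rw [hI]
    have heq : ∫ s in a..b, -(φ (x, s) * φt (x, s)) = (1 / 2) * φ (x, a) ^ 2 := by
      have : ∀ s, -(φ (x, s) * φt (x, s)) = -(1 / 2) * (2 * φ (x, s) * φt (x, s)) := fun s ↦ by ring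
      simp_rw [this]
      rw [intervalIntegral.integral_const_mul, hFTC]
      ring
    rw [heq]
    positivity
  -- (2) the space term is nonnegative (Green with compact support at each time)
  have h2 : 0 ≤ ∫ p, -(φ p * Δφ p) ∂μ₀.prod νt := by
    rw [integral_prod_symm _ hi2]
    refine integral_nonneg fun s ↦ ?_
    change (0 : ℝ) ≤ ∫ x, -(φ (x, s) * Δφ (x, s)) ∂μ₀
    rw [MeasureTheory.integral_neg, neg_nonneg]
    have h2' : (2 : ℕ∞ω) ≤ ((⊤ : ℕ∞) : ℕ∞ω) := WithTop.coe_le_coe.mpr le_top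
    have hcs : HasCompactSupport fun x ↦ φ (x, s) :=
      HasCompactSupport.of_support_subset_isCompact hK fun x hx ↦ by
        by_contra hxK
        exact hx (hφK (x, s) hxK)
    exact integral_mul_laplaceBeltrami_self_nonpos_cs hg ((contMDiff_slice_space hφ s).of_le h2') hcs
  -- (3) assemble with `Q ≥ 1`
  have hsum : ∫ p, -(φ p * φt p) + -(φ p * Δφ p) + Q p.2 p.1 * φ p ^ 2 ∂μ₀.prod νt =
      (∫ p, -(φ p * φt p) ∂μ₀.prod νt) + (∫ p, -(φ p * Δφ p) ∂μ₀.prod νt) +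
        ∫ p, Q p.2 p.1 * φ p ^ 2 ∂μ₀.prod νt := by
    have hi12 : Integrable (fun p ↦ -(φ p * φt p) + -(φ p * Δφ p)) (μ₀.prod νt) := hi1.add hi2
    rw [integral_add hi12 hi3, integral_add hi1 hi2]
  rw [hsum]
  have hcoer' : ∫ p, φ p ^ 2 ∂μ₀.prod νt ≤ ∫ p, Q p.2 p.1 * φ p ^ 2 ∂μ₀.prod νt := by
    refine integral_mono_ae hi0 hi3 ?_
    have hmem : ∀ᵐ p ∂μ₀.prod νt, p ∈ univ ×ˢ Ioo a b := by
      rw [← hπ]; exact ae_restrict_mem (MeasurableSet.univ.prod measurableSet_Ioo)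
    filter_upwards [hmem] with p hp
    have hc := hQ1 p.1 p.2 (Ioo_subset_Icc_self hp.2)
    have hsq : 0 ≤ φ p ^ 2 := sq_nonneg _
    nlinarith
  linarith


/-- **Existence of a very weak `L²` solution of the static linear heat equation with zero initial data on a
complete manifold** (Lions' projection method, Trèves 1975, §41, proof of Thm. 40.1 via Lemma 41.2 — on a
NON-compact `M`). `(M, g)` Riemannian modelled on `ℝⁿ` (Hausdorff, second countable, `T₃`), `Q, G` smooth on
`M × ℝ` with `G` compactly supported, `a < b`, `Q ≥ 1` on `M × [a, b]`. Then there is a measurable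
`u ∈ L²(V_g ⊗ ds)`, zero for `s ∉ (a, b)`, with
`∫ u (−∂ₛζ − Δ_g ζ(·, s) + Qζ) d(V_g ⊗ ds) = ∫_{M×(a,b)} G ζ d(V_g ⊗ ds)` for every smooth compactly
supported `ζ` with `tsupport ζ ⊆ M × (−∞, b)`. Proof: `lions_projection` in `H = L²(M × (a, b))` with the
test space `Φ` of smooth functions vanishing off `K × ℝ` for some compact `K` and for `s ≥ b'` for some
`b' < b`; coercivity is `energy_le_integral_mul_heatAdjoint_static`, the embedding constant is `1`, and
`|∫ Gφ| ≤ ‖G‖₂ ‖φ‖₂`. [cite: Treves1975, §41, Lemma 41.2 and Thm. 40.1] -/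
theorem exists_veryWeak_linearHeat_static (hg : g.IsRiemannian) {Q G : ℝ → M → ℝ}
    (hQ : ContMDiff ((𝓡 n).prod 𝓘(ℝ, ℝ)) 𝓘(ℝ, ℝ) ∞ fun p : M × ℝ ↦ Q p.2 p.1)
    (hG : ContMDiff ((𝓡 n).prod 𝓘(ℝ, ℝ)) 𝓘(ℝ, ℝ) ∞ fun p : M × ℝ ↦ G p.2 p.1)
    (hGc : HasCompactSupport fun p : M × ℝ ↦ G p.2 p.1) {a b : ℝ} (hab : a < b)
    (hQ1 : ∀ (x : M) (s : ℝ), s ∈ Icc a b → 1 ≤ Q s x) :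
    ∃ u : M × ℝ → ℝ, Measurable u ∧ MemLp u 2 (g.riemVolume.prod (volume : Measure ℝ)) ∧
      (∀ p : M × ℝ, p.2 ∉ Ioo a b → u p = 0) ∧
      ∀ ζ : M × ℝ → ℝ, ContMDiff ((𝓡 n).prod 𝓘(ℝ, ℝ)) 𝓘(ℝ, ℝ) ∞ ζ → HasCompactSupport ζ →
        tsupport ζ ⊆ univ ×ˢ Iio b →
        ∫ p, u p * (-(deriv (fun s ↦ ζ (p.1, s)) p.2) - g.laplaceBeltrami (fun x ↦ ζ (x, p.2)) p.1 +
            Q p.2 p.1 * ζ p) ∂(g.riemVolume.prod (volume : Measure ℝ)) =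
          ∫ p in univ ×ˢ Ioo a b, G p.2 p.1 * ζ p ∂(g.riemVolume.prod (volume : Measure ℝ)) := by
  classical
  haveI : LocallyCompactSpace M := ChartedSpace.locallyCompactSpace (EuclideanSpace ℝ (Fin n)) M
  set μ₀ : Measure M := g.riemVolume with hμ₀
  haveI : IsFiniteMeasureOnCompacts μ₀ := CarrilloNi2009_shrinkerLSI.isFiniteMeasureOnCompacts_riemVolume hg
  have hfam : IsContMDiffFamilyOn ∞ (fun _ : ℝ ↦ g) univ := isContMDiffFamilyOn_const g univ
  set S : Set (M × ℝ) := univ ×ˢ Ioo a b with hS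
  have hSm : MeasurableSet S := MeasurableSet.univ.prod measurableSet_Ioo
  set ν : Measure (M × ℝ) := (μ₀.prod (volume : Measure ℝ)).restrict S with hν
  -- the adjoint operator
  set A : (M × ℝ → ℝ) → (M × ℝ → ℝ) := fun φ p ↦
    -(deriv (fun s ↦ φ (p.1, s)) p.2) - g.laplaceBeltrami (fun x ↦ φ (x, p.2)) p.1 +
      Q p.2 p.1 * φ p with hA
  have hAs : ∀ {φ : M × ℝ → ℝ}, ContMDiff ((𝓡 n).prod 𝓘(ℝ, ℝ)) 𝓘(ℝ, ℝ) ∞ φ →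
      ContMDiff ((𝓡 n).prod 𝓘(ℝ, ℝ)) 𝓘(ℝ, ℝ) ∞ (A φ) := fun hφ ↦
    ((contMDiff_deriv_time hφ).neg.sub (contMDiff_laplaceBeltrami_family hfam hφ)).add (hQ.mul hφ)
  -- `A φ` vanishes off `K × ℝ` when `φ` does
  have hA0 : ∀ {φ : M × ℝ → ℝ} {K : Set M}, IsCompact K → (∀ p : M × ℝ, p.1 ∉ K → φ p = 0) →
      ∀ p : M × ℝ, p.1 ∉ K → A φ p = 0 := by
    intro φ K hK hφK p hp
    have ht : (fun s ↦ φ (p.1, s)) = fun _ ↦ (0 : ℝ) := funext fun s ↦ hφK (p.1, s) hp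
    have hev : (fun x ↦ φ (x, p.2)) =ᶠ[𝓝 p.1] fun _ ↦ (0 : ℝ) := by
      filter_upwards [hK.isClosed.isOpen_compl.mem_nhds hp] with x hx
      exact hφK (x, p.2) hx
    simp only [hA]
    rw [ht, deriv_const, laplaceBeltrami_eq_zero_of_eventuallyEq_zero _ hev, hφK p hp]
    ring
  -- continuous functions vanishing off some `K × ℝ` are in `L²(ν)`
  have hmemS : ∀ {F : M × ℝ → ℝ} {K : Set M}, IsCompact K → Continuous F →
      (∀ p : M × ℝ, p.1 ∉ K → F p = 0) → MemLp F 2 ν := by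
    intro F K hK hF hF0
    rw [memLp_two_iff_integrable_sq hF.aestronglyMeasurable]
    have h2 : ∀ p : M × ℝ, p.1 ∉ K → F p ^ 2 = 0 := fun p hp ↦ by rw [hF0 p hp]; ring
    exact integrableOn_strip_of_continuous_of_vanish hg hK (hF.fun_pow 2) h2 a b
  -- the test space: smooth, vanishing off `K × ℝ` for a compact `K`, and for `s ≥ b'`, some `b' < b`
  set Φ : Submodule ℝ (M × ℝ → ℝ) :=
    { carrier := {φ | ContMDiff ((𝓡 n).prod 𝓘(ℝ, ℝ)) 𝓘(ℝ, ℝ) ∞ φ ∧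
        (∃ K : Set M, IsCompact K ∧ ∀ p : M × ℝ, p.1 ∉ K → φ p = 0) ∧
        ∃ b' < b, ∀ p : M × ℝ, b' ≤ p.2 → φ p = 0}
      add_mem' := by
        rintro φ ψ ⟨hφ, ⟨K₁, hK₁, hK₁0⟩, b₁, hb₁, h₁⟩ ⟨hψ, ⟨K₂, hK₂, hK₂0⟩, b₂, hb₂, h₂⟩
        refine ⟨hφ.add hψ, ⟨K₁ ∪ K₂, hK₁.union hK₂, fun p hp ↦ ?_⟩, max b₁ b₂, max_lt hb₁ hb₂,
          fun p hp ↦ ?_⟩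
        · rw [mem_union, not_or] at hp
          simp only [Pi.add_apply, hK₁0 p hp.1, hK₂0 p hp.2, add_zero]
        · simp only [Pi.add_apply, h₁ p ((le_max_left _ _).trans hp), h₂ p ((le_max_right _ _).trans hp),
            add_zero]
      zero_mem' := ⟨contMDiff_const, ⟨∅, isCompact_empty, fun p _ ↦ rfl⟩, b - 1, by linarith,
        fun p _ ↦ rfl⟩
      smul_mem' := by
        rintro c φ ⟨hφ, ⟨K₁, hK₁, hK₁0⟩, b₁, hb₁, h₁⟩
        refine ⟨(contMDiff_const.mul hφ :), ⟨K₁, hK₁, fun p hp ↦ ?_⟩, b₁, hb₁, fun p hp ↦ ?_⟩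
        · change c * φ p = 0
          rw [hK₁0 p hp, mul_zero]
        · change c * φ p = 0
          rw [h₁ p hp, mul_zero] } with hΦ
  have hΦs : ∀ φ : Φ, ContMDiff ((𝓡 n).prod 𝓘(ℝ, ℝ)) 𝓘(ℝ, ℝ) ∞ (φ : M × ℝ → ℝ) := fun φ ↦ φ.2.1
  have hΦK : ∀ φ : Φ, ∃ K : Set M, IsCompact K ∧ ∀ p : M × ℝ, p.1 ∉ K → (φ : M × ℝ → ℝ) p = 0 :=
    fun φ ↦ φ.2.2.1
  have hΦb : ∀ φ : Φ, ∀ x : M, ∀ s, b ≤ s → (φ : M × ℝ → ℝ) (x, s) = 0 := by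
    intro φ x s hs
    obtain ⟨b', hb', h'⟩ := φ.2.2.2
    exact h' (x, s) (hb'.le.trans hs)
  -- the linear maps into `L²(ν)`
  have hmemφ : ∀ φ : Φ, MemLp (φ : M × ℝ → ℝ) 2 ν := fun φ ↦ by
    obtain ⟨K, hK, hK0⟩ := hΦK φ
    exact hmemS hK (hΦs φ).continuous hK0
  have hmemA : ∀ φ : Φ, MemLp (A φ) 2 ν := fun φ ↦ by
    obtain ⟨K, hK, hK0⟩ := hΦK φ
    exact hmemS hK (hAs (hΦs φ)).continuous (hA0 hK hK0)
  set j : Φ →ₗ[ℝ] Lp ℝ 2 ν :=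
    { toFun := fun φ ↦ (hmemφ φ).toLp (φ : M × ℝ → ℝ)
      map_add' := fun φ ψ ↦ MemLp.toLp_add (hmemφ φ) (hmemφ ψ)
      map_smul' := fun c φ ↦ MemLp.toLp_const_smul c (hmemφ φ) } with hj
  have hAadd : ∀ φ ψ : Φ, A ((φ + ψ : Φ) : M × ℝ → ℝ) = A φ + A ψ := by
    intro φ ψ; funext p
    exact heatAdjoint_static_add Q (hΦs φ) (hΦs ψ) p
  have hAsmul : ∀ (c : ℝ) (φ : Φ), A ((c • φ : Φ) : M × ℝ → ℝ) = c • A φ := by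
    intro c φ; funext p
    exact heatAdjoint_static_smul Q (hΦs φ) c p
  set K : Φ →ₗ[ℝ] Lp ℝ 2 ν :=
    { toFun := fun φ ↦ (hmemA φ).toLp (A φ)
      map_add' := fun φ ψ ↦ by
        have h1 : (hmemA (φ + ψ)).toLp (A ((φ + ψ : Φ) : M × ℝ → ℝ)) =
            ((hmemA φ).add (hmemA ψ)).toLp (A φ + A ψ) :=
          MemLp.toLp_congr _ _ (Eventually.of_forall fun p ↦ by rw [hAadd])
        rw [h1]; exact MemLp.toLp_add (hmemA φ) (hmemA ψ)
      map_smul' := fun c φ ↦ by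
        have h1 : (hmemA (c • φ)).toLp (A ((c • φ : Φ) : M × ℝ → ℝ)) =
            ((hmemA φ).const_smul c).toLp (c • A φ) :=
          MemLp.toLp_congr _ _ (Eventually.of_forall fun p ↦ by rw [hAsmul])
        rw [h1]; exact MemLp.toLp_const_smul c (hmemA φ) } with hK
  -- `G` vanishes off `KG × ℝ`, `KG` compact
  set KG : Set M := Prod.fst '' tsupport (fun p : M × ℝ ↦ G p.2 p.1) with hKG
  have hKGc : IsCompact KG := hGc.isCompact.image continuous_fst
  have hG0 : ∀ p : M × ℝ, p.1 ∉ KG → G p.2 p.1 = 0 := fun p hp ↦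
    image_eq_zero_of_notMem_tsupport (f := fun p : M × ℝ ↦ G p.2 p.1) fun h ↦ hp ⟨p, h, rfl⟩
  have hGmem : MemLp (fun p : M × ℝ ↦ G p.2 p.1) 2 ν := hmemS hKGc hG.continuous hG0
  set ℓ : Φ →ₗ[ℝ] ℝ :=
    { toFun := fun φ ↦ ∫ p, G p.2 p.1 * (φ : M × ℝ → ℝ) p ∂ν
      map_add' := fun φ ψ ↦ by
        have hi : ∀ θ : Φ, Integrable (fun p ↦ G p.2 p.1 * (θ : M × ℝ → ℝ) p) ν := fun θ ↦ by
          have h0 : ∀ p : M × ℝ, p.1 ∉ KG → G p.2 p.1 * (θ : M × ℝ → ℝ) p = 0 := fun p hp ↦ by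
            rw [hG0 p hp, zero_mul]
          exact integrableOn_strip_of_continuous_of_vanish hg hKGc
            (hG.continuous.fun_mul (hΦs θ).continuous) h0 a b
        rw [← integral_add (hi φ) (hi ψ)]
        exact integral_congr_ae (Eventually.of_forall fun p ↦ by
          simp only [Submodule.coe_add, Pi.add_apply]; ring)
      map_smul' := fun c φ ↦ by
        rw [RingHom.id_apply, smul_eq_mul, ← MeasureTheory.integral_const_mul]
        exact integral_congr_ae (Eventually.of_forall fun p ↦ by
          simp only [Submodule.coe_smul, Pi.smul_apply, smul_eq_mul]; ring) } with hℓ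
  -- the gauge and the constant
  set nΦ : Φ → ℝ := fun φ ↦ Real.sqrt (∫ p, (φ : M × ℝ → ℝ) p ^ 2 ∂ν) with hnΦ
  set C₁ : ℝ := Real.sqrt (∫ p, G p.2 p.1 ^ 2 ∂ν) with hC₁
  -- (i) coercivity
  have hcoerc : ∀ φ : Φ, 1 * nΦ φ ^ 2 ≤ ⟪K φ, j φ⟫_ℝ := by
    intro φ
    have hint_eq : ⟪K φ, j φ⟫_ℝ = ∫ p, A φ p * (φ : M × ℝ → ℝ) p ∂ν :=
      inner_toLp_toLp_eq_integral (hmemA φ) (hmemφ φ)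
    rw [one_mul, hint_eq, hnΦ]
    dsimp only
    rw [Real.sq_sqrt (integral_nonneg fun p ↦ sq_nonneg _)]
    obtain ⟨K', hK', hK'0⟩ := hΦK φ
    have hen := energy_le_integral_mul_heatAdjoint_static hg hQ hab hQ1 hK' (hΦs φ) hK'0 (hΦb φ)
    rw [hν]
    calc ∫ p in S, (φ : M × ℝ → ℝ) p ^ 2 ∂μ₀.prod (volume : Measure ℝ)
        ≤ _ := hen
      _ = ∫ p in S, A φ p * (φ : M × ℝ → ℝ) p ∂μ₀.prod (volume : Measure ℝ) :=
          integral_congr_ae (Eventually.of_forall fun p ↦ by simp only [hA]; ring)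
  -- (ii) the inclusion is bounded (constant `1`)
  have hemb : ∀ φ : Φ, ‖j φ‖ ≤ 1 * nΦ φ := by
    intro φ
    change ‖(hmemφ φ).toLp (φ : M × ℝ → ℝ)‖ ≤ 1 * nΦ φ
    rw [norm_toLp_two_eq_sqrt, one_mul]
  -- (iii) the functional is bounded (Cauchy–Schwarz)
  have hℓb : ∀ φ : Φ, |ℓ φ| ≤ C₁ * nΦ φ := by
    intro φ
    change |∫ p, G p.2 p.1 * (φ : M × ℝ → ℝ) p ∂ν| ≤ C₁ * nΦ φ
    have hcs := abs_real_inner_le_norm (hGmem.toLp _) ((hmemφ φ).toLp _)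
    rw [inner_toLp_toLp_eq_integral, norm_toLp_two_eq_sqrt, norm_toLp_two_eq_sqrt] at hcs
    exact hcs
  -- Lions' projection lemma
  obtain ⟨U, hU⟩ := Literature.Analysis.PDE.lions_projection K j ℓ nΦ one_pos zero_le_one (Real.sqrt_nonneg _)
    (fun φ ↦ Real.sqrt_nonneg _) hcoerc hemb hℓb
  -- a measurable representative, extended by zero off the strip
  set Ut : M × ℝ → ℝ := (Lp.memLp U).1.mk U with hUt
  have hUtm : Measurable Ut := (Lp.memLp U).1.stronglyMeasurable_mk.measurable
  have hUUt : (U : M × ℝ → ℝ) =ᵐ[ν] Ut := (Lp.memLp U).1.ae_eq_mk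
  have hUt2 : MemLp Ut 2 ν := (Lp.memLp U).ae_eq hUUt
  set u : M × ℝ → ℝ := S.indicator Ut with hu
  refine ⟨u, hUtm.indicator hSm, ?_, ?_, ?_⟩
  · rw [hu, memLp_indicator_iff_restrict hSm]; exact hUt2
  · intro p hp
    rw [hu, indicator_of_notMem (fun h' : p ∈ S ↦ hp h'.2)]
  · intro ζ hζ hζc hζT
    -- `ζ` belongs to the test space
    have hζΦ : ζ ∈ Φ := by
      refine ⟨hζ, ⟨Prod.fst '' tsupport ζ, hζc.isCompact.image continuous_fst, fun p hp ↦
        image_eq_zero_of_notMem_tsupport fun h ↦ hp ⟨p, h, rfl⟩⟩, ?_⟩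
      set Kt : Set ℝ := Prod.snd '' tsupport ζ with hKt
      have hKtc : IsCompact Kt := hζc.isCompact.image continuous_snd
      rcases Kt.eq_empty_or_nonempty with he | hne
      · refine ⟨b - 1, by linarith, fun p _ ↦ ?_⟩
        have : p ∉ tsupport ζ := fun h' ↦ by
          have : p.2 ∈ Kt := ⟨p, h', rfl⟩
          rw [he] at this; exact this
        exact image_eq_zero_of_notMem_tsupport this
      · obtain ⟨s₀, hs₀, hmax⟩ := hKtc.exists_isMaxOn hne continuous_id.continuousOn
        obtain ⟨p₀, hp₀, rfl⟩ := hs₀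
        have hs₀b : p₀.2 < b := (hζT hp₀).2
        refine ⟨(p₀.2 + b) / 2, by linarith, fun p hp ↦ ?_⟩
        have : p ∉ tsupport ζ := fun h' ↦ by
          have hle : p.2 ≤ p₀.2 := hmax ⟨p, h', rfl⟩
          linarith
        exact image_eq_zero_of_notMem_tsupport this
    have key := hU ⟨ζ, hζΦ⟩
    -- unfold both sides
    have hKζ : ⟪U, K ⟨ζ, hζΦ⟩⟫_ℝ = ∫ p, Ut p * A ζ p ∂ν := by
      have h1 : ⟪U, K ⟨ζ, hζΦ⟩⟫_ℝ = ⟪hUt2.toLp Ut, (hmemA ⟨ζ, hζΦ⟩).toLp (A ζ)⟫_ℝ := by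
        congr 1
        exact (Lp.toLp_coeFn U (Lp.memLp U)).symm.trans (MemLp.toLp_congr _ _ hUUt)
      rw [h1, inner_toLp_toLp_eq_integral]
    rw [hKζ] at key
    change ∫ p, Ut p * A ζ p ∂ν = ∫ p, G p.2 p.1 * ζ p ∂ν at key
    rw [hν] at key
    have hlhs : ∫ p, u p * A ζ p ∂μ₀.prod (volume : Measure ℝ) =
        ∫ p in S, Ut p * A ζ p ∂μ₀.prod (volume : Measure ℝ) := by
      rw [← MeasureTheory.integral_indicator hSm]
      refine integral_congr_ae (Eventually.of_forall fun p ↦ ?_)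
      simp only [hu]
      by_cases hp : p ∈ S
      · rw [indicator_of_mem hp, indicator_of_mem hp]
      · rw [indicator_of_notMem hp, indicator_of_notMem hp, zero_mul]
    rw [hlhs]
    exact key


omit [T2Space M] [SecondCountableTopology M] [T3Space M] [MeasurableSpace M] [BorelSpace M] in
/-- **The static adjoint `−∂ₛζ − Δ_g ζ(·, s) + Qζ` of a test function vanishes off its support.**
[folklore] -/
theorem staticHeatAdjoint_eq_zero_of_notMem_tsupport [g.HasLeviCivita] (Q : ℝ → M → ℝ)
    {ζ : M × ℝ → ℝ} {p : M × ℝ} (hp : p ∉ tsupport ζ) :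
    -(deriv (fun s ↦ ζ (p.1, s)) p.2) - g.laplaceBeltrami (fun x ↦ ζ (x, p.2)) p.1 + Q p.2 p.1 * ζ p = 0 := by
  have hev : ζ =ᶠ[𝓝 p] fun _ ↦ 0 := notMem_tsupport_iff_eventuallyEq.1 hp
  have h1 : (fun s ↦ ζ (p.1, s)) =ᶠ[𝓝 p.2] fun _ ↦ 0 := by
    have hc : Tendsto (fun s : ℝ ↦ (p.1, s)) (𝓝 p.2) (𝓝 p) :=
      (Continuous.prodMk_right p.1).tendsto p.2
    exact hev.comp_tendsto hc
  have h2 : (fun x ↦ ζ (x, p.2)) =ᶠ[𝓝 p.1] fun _ ↦ 0 := by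
    have hc : Tendsto (fun x : M ↦ (x, p.2)) (𝓝 p.1) (𝓝 p) :=
      (Continuous.prodMk_left p.2).tendsto p.1
    exact hev.comp_tendsto hc
  rw [h1.deriv_eq, deriv_const, laplaceBeltrami_eq_dalembertian,
    g.dalembertian_eq_zero_of_eventuallyEq_zero h2, image_eq_zero_of_notMem_tsupport hp]
  simp

namespace IsVeryWeakHeatSol

omit [T2Space M] [SecondCountableTopology M] in
/-- A very weak solution on `M × T` is one on `M × T'` for every `T' ⊆ T`. [folklore] -/
theorem mono {Q G : ℝ → M → ℝ} {T T' : Set ℝ} {u : M × ℝ → ℝ} (hu : IsVeryWeakHeatSol g Q G T u)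
    (hT' : T' ⊆ T) : IsVeryWeakHeatSol g Q G T' u :=
  ⟨hu.locallyIntegrableOn.mono_set (prod_mono le_rfl hT'),
    fun ζ hζ hζc hζT ↦ hu.integral_eq ζ hζ hζc (hζT.trans (prod_mono le_rfl hT'))⟩

omit [T2Space M] [SecondCountableTopology M] in
/-- Very weak solutions are stable under modification on a null set of `M × T` (local integrability and
the identity pass to the a.e.-equal function). [folklore] -/
theorem congr_ae [g.HasLeviCivita] {Q G : ℝ → M → ℝ} {T : Set ℝ} (hT : IsOpen T) {u v : M × ℝ → ℝ}
    (hu : IsVeryWeakHeatSol g Q G T u)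
    (hae : ∀ᵐ p ∂g.riemVolume.prod (volume : Measure ℝ), p ∈ univ ×ˢ T → u p = v p) :
    IsVeryWeakHeatSol g Q G T v := by
  have hae' : ∀ᵐ p ∂(g.riemVolume.prod (volume : Measure ℝ)).restrict (univ ×ˢ T), u p = v p := by
    rw [ae_restrict_iff' (MeasurableSet.univ.prod hT.measurableSet)]
    exact hae
  refine ⟨?_, fun ζ hζ hζc hζT ↦ ?_⟩
  · intro p hp
    obtain ⟨U, hU, hint⟩ := hu.locallyIntegrableOn p hp
    refine ⟨U ∩ univ ×ˢ T, inter_mem hU self_mem_nhdsWithin, ?_⟩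
    refine (hint.mono_set inter_subset_left).congr_fun_ae ?_
    exact ae_restrict_of_ae_restrict_of_subset inter_subset_right hae'
  · rw [← hu.integral_eq ζ hζ hζc hζT]
    refine integral_congr_ae ?_
    filter_upwards [hae] with p hp
    by_cases hpz : p ∈ tsupport ζ
    · rw [hp (hζT hpz)]
    · simp only [staticHeatAdjoint_eq_zero_of_notMem_tsupport Q hpz, mul_zero]

end IsVeryWeakHeatSol

/-- **Very weak solution of the static linear heat equation on the open half space-time `M × (−∞, b)`
with forcing supported in `s ≥ a`** (the form consumed by the Cauchy problem): if moreover `G = 0` for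
`s ≤ a`, the zero extension `u` of Lions' solution on the strip `M × (a, b)` is a very weak solution of
`∂ₛu = Δ_g u − Qu + G` on `M × (−∞, b)` (`IsVeryWeakHeatSol g Q G (Iio b) u`), measurable, in
`L²(V_g ⊗ ds)` (hence locally integrable) and `= 0` for `s ∉ (a, b)`.
[cite: Treves1975, §41, Lemma 41.2 and Thm. 40.1] -/
theorem exists_isVeryWeakHeatSol_static (hg : g.IsRiemannian) {Q G : ℝ → M → ℝ}
    (hQ : ContMDiff ((𝓡 n).prod 𝓘(ℝ, ℝ)) 𝓘(ℝ, ℝ) ∞ fun p : M × ℝ ↦ Q p.2 p.1)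
    (hG : ContMDiff ((𝓡 n).prod 𝓘(ℝ, ℝ)) 𝓘(ℝ, ℝ) ∞ fun p : M × ℝ ↦ G p.2 p.1)
    (hGc : HasCompactSupport fun p : M × ℝ ↦ G p.2 p.1) {a b : ℝ} (hab : a < b)
    (hG0 : ∀ s ≤ a, ∀ x, G s x = 0) (hQ1 : ∀ (x : M) (s : ℝ), s ∈ Icc a b → 1 ≤ Q s x) :
    ∃ u : M × ℝ → ℝ, Measurable u ∧ MemLp u 2 (g.riemVolume.prod (volume : Measure ℝ)) ∧
      (∀ p : M × ℝ, p.2 ∉ Ioo a b → u p = 0) ∧ IsVeryWeakHeatSol g Q G (Iio b) u := by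
  haveI : LocallyCompactSpace M := ChartedSpace.locallyCompactSpace (EuclideanSpace ℝ (Fin n)) M
  haveI := CarrilloNi2009_shrinkerLSI.isFiniteMeasureOnCompacts_riemVolume hg
  haveI : IsLocallyFiniteMeasure g.riemVolume := isLocallyFiniteMeasure_of_isFiniteMeasureOnCompacts
  obtain ⟨u, hum, hu2, hu0, huweak⟩ := exists_veryWeak_linearHeat_static hg hQ hG hGc hab hQ1
  refine ⟨u, hum, hu2, hu0, ⟨(hu2.locallyIntegrable (by norm_num)).locallyIntegrableOn _,
    fun ζ hζ hζc hζb ↦ ?_⟩⟩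
  rw [huweak ζ hζ hζc hζb]
  refine setIntegral_eq_integral_of_forall_compl_eq_zero fun p hp ↦ ?_
  by_cases hpb : p.2 < b
  · have hpa : p.2 ≤ a := by
      by_contra h'
      exact hp ⟨mem_univ _, not_le.1 h', hpb⟩
    rw [hG0 p.2 hpa p.1, zero_mul]
  · have hp' : p ∉ tsupport ζ := fun h' ↦ hpb (hζb h').2
    rw [image_eq_zero_of_notMem_tsupport hp', mul_zero]

end VeryWeakStatic

end Literature.Geometry.Riemannian

end
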